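import Literature.NumberTheory.GaloisRepresentations.LubinTateColeman
import Mathlib.RingTheory.AdicCompletion.Basic
import HarnessLib

/-!
# The twisted fixed point `h = g + u · (h^ψ ∘ f)` in `S⟦X⟧` for a `(p)`-adically complete ring `S`
# (de Shalit I §3.13 over an unramified base: `h ↦ h̃ = h − u·h^φ ∘ f` is onto the trace-zero series)

De Shalit, *Iwasawa theory of elliptic curves with complex multiplication* (1987), Ch. I §3.13 Lemma: for `𝒮h = h^φ`
the series `h̃ = h − h^φ ∘ [p]` is the power series of a measure on the units, and conversely EVERY trace-zero series
`g` (with the right constant term) is `h̃` for a unique `h`: one solves `h = g + u·(h^φ ∘ f)` (`φ` the Frobenius of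
the unramified base acting on coefficients).  The tree has the untwisted case over `𝒪[F]`
(`LubinTateColemanTraceZero`: `exists_eq_add_C_mul_subst`, `φ = id`).  This file proves the twisted fixed-point theorem
in the generality needed for the relative (unramified-base) theory: any commutative ring `S`, an element `p ∈ S`, a
series `f ∈ S⟦X⟧` with `f(0) = 0` and `p ∣ f'(0)` (e.g. a Lubin–Tate series `πX + X^q`), a ring endomorphism `ψ` of
`S` with `ψ(p) = p` (e.g. a Frobenius lift), and a constant `u`:

* `LubinTate.adicFiltGen p N` — the coefficientwise `(p, X)`-adic filtration `I_N = {V : coeff_k V ∈ (p^{N−k})}` of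
  `S⟦X⟧` with `adicFiltGen_mono`, `mul_mem_adicFiltGen` (`I_a I_b ⊆ I_{a+b}`), `map_mem_adicFiltGen` (`ψ`-stability),
  ★ `subst_mem_adicFiltGen_succ` — **`d ∈ I_N`, `d(0) = 0 ⟹ d ∘ f ∈ I_{N+1}`**;
* `exists_forall_sub_mem_adicFiltGen` (`(p, X)`-adic Cauchy sequences converge when `S` is `(p)`-adically
  precomplete), `eq_zero_of_forall_mem_adicFiltGen` (`⋂ I_N = 0` when `S` is `(p)`-adically Hausdorff);
* `twistFixSeq` — the approximants `h_0 = 0`, `h_{M+1} = g + u·(h_M^ψ ∘ f)`, and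
  ★★ `exists_eq_add_C_mul_map_subst` — **for `g(0) = 0` there is `h` with `h(0) = 0` and `h = g + u·(h^ψ ∘ f)`**
  (`[IsAdicComplete (p) S]`), ★ `eq_of_eq_add_C_mul_map_subst` — **unique given the constant term**
  (`[IsHausdorff (p) S]`).

0 sorry, no named facts; pure algebra (no local fields).  Instances: `S = 𝒪[F]` (tree), `S = 𝒪_E` for a finite
`E ⊇ F` (the unramified bases of the two-variable tower; sequel).

## References

* E. de Shalit, *Iwasawa theory of elliptic curves with complex multiplication* (1987), Ch. I §3.13 Lemma, §3.14.
  [deShalit1987]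
-/

noncomputable section

namespace Literature.NumberTheory.GaloisRepresentations

namespace LubinTate

section AdicFixedPoint

variable {S : Type*} [CommRing S] (p : S)

/-! ### The `(p, X)`-adic filtration of `S⟦X⟧` -/

/-- `I_N = {V : coeff_k V ∈ (p^{N−k}) for all k}` — the `N`-th power of `(p, X)`, coefficientwise.
[cite: deShalit1987, Ch. I §3.13 Lemma (proof)] -/
def adicFiltGen (N : ℕ) : Ideal (PowerSeries S) where
  carrier := {V | ∀ k, PowerSeries.coeff k V ∈ Ideal.span {p ^ (N - k)}}
  add_mem' {a b} ha hb k := by rw [map_add]; exact add_mem (ha k) (hb k)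
  zero_mem' k := by rw [map_zero]; exact zero_mem _
  smul_mem' c V hV k := by
    rw [smul_eq_mul, PowerSeries.coeff_mul]
    refine Ideal.sum_mem _ fun x hx => ?_
    have hx' := Finset.mem_antidiagonal.mp hx
    refine Ideal.mul_mem_left _ _ (Ideal.mem_span_singleton.mpr ?_)
    exact dvd_trans (pow_dvd_pow _ (by omega)) (Ideal.mem_span_singleton.mp (hV x.2))

variable {p}

/-- Membership in `I_N` (unfolding). [cite: deShalit1987, Ch. I §3.13 Lemma (proof)] -/
theorem mem_adicFiltGen_iff {N : ℕ} {V : PowerSeries S} :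
    V ∈ adicFiltGen p N ↔ ∀ k, PowerSeries.coeff k V ∈ Ideal.span {p ^ (N - k)} := Iff.rfl

/-- `I_a ⊆ I_b` for `b ≤ a`. [cite: deShalit1987, Ch. I §3.13 Lemma (proof)] -/
theorem adicFiltGen_mono {a b : ℕ} (hab : b ≤ a) : adicFiltGen p a ≤ adicFiltGen p b := fun V hV k =>
  Ideal.mem_span_singleton.mpr (dvd_trans (pow_dvd_pow _ (by omega)) (Ideal.mem_span_singleton.mp (hV k)))

/-- `I_0 = S⟦X⟧`. [cite: deShalit1987, Ch. I §3.13 Lemma (proof)] -/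
theorem mem_adicFiltGen_zero (V : PowerSeries S) : V ∈ adicFiltGen p 0 := fun k => by
  rw [Nat.zero_sub, pow_zero, Ideal.span_singleton_one]; exact Submodule.mem_top

/-- A constant `c ∈ (p^N)` lies in `I_N`. [cite: deShalit1987, Ch. I §3.13 Lemma (proof)] -/
theorem C_mem_adicFiltGen {N : ℕ} {c : S} (hc : c ∈ Ideal.span {p ^ N}) : PowerSeries.C c ∈ adicFiltGen p N := by
  intro k
  rw [PowerSeries.coeff_C]
  split_ifs with hk
  · subst hk; rwa [Nat.sub_zero]
  · exact zero_mem _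

/-- A series without constant term lies in `I_1`. [cite: deShalit1987, Ch. I §3.13 Lemma (proof)] -/
theorem mem_adicFiltGen_one_of_constantCoeff_eq_zero {d : PowerSeries S} (hd : PowerSeries.constantCoeff d = 0) :
    d ∈ adicFiltGen p 1 := by
  intro k
  rcases Nat.eq_zero_or_pos k with rfl | hk
  · rw [PowerSeries.coeff_zero_eq_constantCoeff, hd]; exact zero_mem _
  · rw [show 1 - k = 0 by omega, pow_zero, Ideal.span_singleton_one]; exact Submodule.mem_top

/-- The shift `(d − d(0))/X` of `d ∈ I_N` lies in `I_{N−1}`. [cite: deShalit1987, Ch. I §3.13 Lemma (proof)] -/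
theorem shift_mem_adicFiltGen {N : ℕ} {d : PowerSeries S} (hd : d ∈ adicFiltGen p N) :
    (PowerSeries.mk fun i => PowerSeries.coeff (i + 1) d) ∈ adicFiltGen p (N - 1) := fun k => by
  rw [PowerSeries.coeff_mk, show N - 1 - k = N - (k + 1) by omega]; exact hd (k + 1)

/-- `I_a · I_b ⊆ I_{a+b}`. [cite: deShalit1987, Ch. I §3.13 Lemma (proof)] -/
theorem mul_mem_adicFiltGen {a b : ℕ} {U V : PowerSeries S} (hU : U ∈ adicFiltGen p a) (hV : V ∈ adicFiltGen p b) :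
    U * V ∈ adicFiltGen p (a + b) := by
  intro k
  rw [PowerSeries.coeff_mul]
  refine Ideal.sum_mem _ fun x hx => ?_
  have hx' := Finset.mem_antidiagonal.mp hx
  obtain ⟨c, hc⟩ := Ideal.mem_span_singleton.mp (hU x.1)
  obtain ⟨d, hd⟩ := Ideal.mem_span_singleton.mp (hV x.2)
  rw [hc, hd, show p ^ (a - x.1) * c * (p ^ (b - x.2) * d) = p ^ (a - x.1 + (b - x.2)) * (c * d) by rw [pow_add]; ring]
  exact Ideal.mul_mem_right _ _ (Ideal.mem_span_singleton.mpr (pow_dvd_pow _ (by omega)))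

/-- A ring endomorphism `ψ` with `ψ(p) = p` preserves `I_N` (coefficientwise). [cite: deShalit1987, Ch. I §3.13 Lemma (proof)] -/
theorem map_mem_adicFiltGen {ψ : S →+* S} (hψ : ψ p = p) {N : ℕ} {V : PowerSeries S} (hV : V ∈ adicFiltGen p N) :
    PowerSeries.map ψ V ∈ adicFiltGen p N := fun k => by
  rw [PowerSeries.coeff_map]
  obtain ⟨c, hc⟩ := Ideal.mem_span_singleton.mp (hV k)
  rw [hc, map_mul, map_pow, hψ]
  exact Ideal.mem_span_singleton.mpr (dvd_mul_right _ _)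

/-! ### `∘ f` raises the filtration -/

variable {f : PowerSeries S} (hf0 : PowerSeries.constantCoeff f = 0) (hf1 : p ∣ PowerSeries.coeff 1 f)
include hf0

/-- `f ∈ I_1`. [cite: deShalit1987, Ch. I §3.13 Lemma (proof)] -/
theorem mem_adicFiltGen_one_self : f ∈ adicFiltGen p 1 := mem_adicFiltGen_one_of_constantCoeff_eq_zero hf0

include hf1 in
/-- `c ∈ (p^N) ⟹ c · f ∈ I_{N+2}` (`f(0) = 0`, `p ∣ f₁`). [cite: deShalit1987, Ch. I §3.13 Lemma (proof)] -/
theorem C_mul_mem_adicFiltGen {N : ℕ} {c : S} (hc : c ∈ Ideal.span {p ^ N}) :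
    PowerSeries.C c * f ∈ adicFiltGen p (N + 2) := by
  intro k
  rw [PowerSeries.coeff_C_mul]
  rcases Nat.lt_trichotomy k 1 with hk | rfl | hk
  · have hk0 : k = 0 := by omega
    subst hk0
    rw [PowerSeries.coeff_zero_eq_constantCoeff, hf0, mul_zero]
    exact zero_mem _
  · rw [show N + 2 - 1 = N + 1 by omega, pow_succ]
    exact Ideal.mem_span_singleton.mpr (mul_dvd_mul (Ideal.mem_span_singleton.mp hc) hf1)
  · exact Ideal.mul_mem_right _ _ (Ideal.mem_span_singleton.mpr
      (dvd_trans (pow_dvd_pow _ (by omega)) (Ideal.mem_span_singleton.mp hc)))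

include hf1 in
/-- ★ **`∘ f` raises the filtration on series without constant term**: `d ∈ I_N`, `d(0) = 0 ⟹ d ∘ f ∈ I_{N+1}`.
[cite: deShalit1987, Ch. I §3.13 Lemma (proof)] -/
theorem subst_mem_adicFiltGen_succ : ∀ (N : ℕ) {d : PowerSeries S}, d ∈ adicFiltGen p N →
    PowerSeries.constantCoeff d = 0 → PowerSeries.subst f d ∈ adicFiltGen p (N + 1) := by
  have hfs : PowerSeries.HasSubst f := PowerSeries.HasSubst.of_constantCoeff_zero' hf0
  intro N
  induction N with
  | zero =>
    intro d _ hd0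
    have e := PowerSeries.eq_X_mul_shift_add_const d
    rw [hd0, map_zero, add_zero] at e
    rw [e, PowerSeries.subst_mul hfs, PowerSeries.subst_X hfs]
    simpa using mul_mem_adicFiltGen (p := p) (mem_adicFiltGen_one_self hf0) (mem_adicFiltGen_zero (p := p) _)
  | succ N ih =>
    intro d hd hd0
    set d' : PowerSeries S := PowerSeries.mk fun i => PowerSeries.coeff (i + 1) d with hd'
    have hd'mem : d' ∈ adicFiltGen p N := by simpa using shift_mem_adicFiltGen (p := p) hd
    have e := PowerSeries.eq_X_mul_shift_add_const d
    rw [hd0, map_zero, add_zero] at e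
    set c : S := PowerSeries.constantCoeff d' with hc
    have hcmem : c ∈ Ideal.span {p ^ N} := by
      have := hd'mem 0
      rwa [Nat.sub_zero, PowerSeries.coeff_zero_eq_constantCoeff] at this
    set e' : PowerSeries S := d' - PowerSeries.C c with he'
    have he'mem : e' ∈ adicFiltGen p N := sub_mem hd'mem (C_mem_adicFiltGen hcmem)
    have he'0 : PowerSeries.constantCoeff e' = 0 := by
      rw [he', map_sub, PowerSeries.constantCoeff_C, hc, sub_self]
    have hd'eq : d' = e' + PowerSeries.C c := by rw [he', sub_add_cancel]
    have key : PowerSeries.subst f d = f * PowerSeries.subst f e' + PowerSeries.C c * f := by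
      rw [e, PowerSeries.subst_mul hfs, PowerSeries.subst_X hfs]
      change f * PowerSeries.subst f d' = _
      rw [hd'eq, PowerSeries.subst_add hfs, PowerSeries.subst_C]
      change f * (PowerSeries.subst f e' + PowerSeries.C c) = _
      ring
    rw [key]
    refine add_mem ?_ (C_mul_mem_adicFiltGen hf0 hf1 hcmem)
    have := mul_mem_adicFiltGen (p := p) (mem_adicFiltGen_one_self hf0) (ih he'mem he'0)
    rwa [show 1 + (N + 1) = N + 1 + 1 by ring] at this

omit hf0

/-! ### `(p, X)`-adic limits -/

/-- ★ **`(p, X)`-adically Cauchy sequences converge** when `S` is `(p)`-adically precomplete: if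
`s_{N+1} − s_N ∈ I_{N+1}` for all `N`, there is `H` with `H − s_N ∈ I_{N+1}` for all `N`.
[cite: deShalit1987, Ch. I §3.13 Lemma (proof)] -/
theorem exists_forall_sub_mem_adicFiltGen [IsPrecomplete (Ideal.span {p}) S] (s : ℕ → PowerSeries S)
    (hs : ∀ N, s (N + 1) - s N ∈ adicFiltGen p (N + 1)) :
    ∃ H : PowerSeries S, ∀ N, H - s N ∈ adicFiltGen p (N + 1) := by
  have hle : ∀ {N M : ℕ}, N ≤ M → s M - s N ∈ adicFiltGen p (N + 1) := by
    intro N M hNM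
    induction M, hNM using Nat.le_induction with
    | base => rw [sub_self]; exact zero_mem _
    | succ M hNM ih =>
      have e : s (M + 1) - s N = (s (M + 1) - s M) + (s M - s N) := by ring
      rw [e]
      exact add_mem (adicFiltGen_mono (by omega) (hs M)) ih
  have hcoef : ∀ k : ℕ, ∃ L : S, ∀ N : ℕ,
      PowerSeries.coeff k (s (N + k)) ≡ L [SMOD (Ideal.span {p} ^ N • ⊤ : Submodule S S)] := by
    intro k
    refine IsPrecomplete.prec' (fun N => PowerSeries.coeff k (s (N + k))) fun {M N} hMN => ?_
    rw [SModEq.sub_mem, smul_eq_mul, Ideal.mul_top, Ideal.span_singleton_pow, ← neg_sub, neg_mem_iff, ← map_sub]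
    have hmem := hle (show M + k ≤ N + k by omega) k
    exact Ideal.mem_span_singleton.mpr (dvd_trans (pow_dvd_pow _ (by omega)) (Ideal.mem_span_singleton.mp hmem))
  choose L hL using hcoef
  refine ⟨PowerSeries.mk L, fun N k => ?_⟩
  rw [map_sub, PowerSeries.coeff_mk]
  rcases Nat.lt_or_ge (N + 1) k with hlt | hge
  · rw [show N + 1 - k = 0 by omega, pow_zero, Ideal.span_singleton_one]; exact Submodule.mem_top
  · have h1 := hL k (N + 1 - k)
    rw [SModEq.sub_mem, smul_eq_mul, Ideal.mul_top, Ideal.span_singleton_pow,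
      show N + 1 - k + k = N + 1 by omega] at h1
    have h2 := hs N k
    rw [map_sub] at h2
    rw [show L k - PowerSeries.coeff k (s N) = (PowerSeries.coeff k (s (N + 1)) - PowerSeries.coeff k (s N)) -
      (PowerSeries.coeff k (s (N + 1)) - L k) by ring]
    exact sub_mem h2 h1

/-- **`⋂_N I_N = 0`** when `S` is `(p)`-adically Hausdorff. [cite: deShalit1987, Ch. I §3.14] -/
theorem eq_zero_of_forall_mem_adicFiltGen [IsHausdorff (Ideal.span {p}) S] {V : PowerSeries S}
    (hV : ∀ N, V ∈ adicFiltGen p N) : V = 0 := by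
  ext k
  rw [map_zero]
  refine IsHausdorff.haus' (I := Ideal.span {p}) _ fun i => ?_
  rw [SModEq.sub_mem, sub_zero, smul_eq_mul, Ideal.mul_top, Ideal.span_singleton_pow]
  have := hV (k + i) k
  rwa [show k + i - k = i by omega] at this

/-- `(G^ψ)(0) = ψ(G(0))`. [cite: deShalit1987, Ch. I §3.13 Lemma (proof)] -/
private theorem constantCoeff_map' (ψ : S →+* S) (G : PowerSeries S) :
    PowerSeries.constantCoeff (PowerSeries.map ψ G) = ψ (PowerSeries.constantCoeff G) := by
  rw [← PowerSeries.coeff_zero_eq_constantCoeff_apply, PowerSeries.coeff_map, PowerSeries.coeff_zero_eq_constantCoeff_apply]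

/-! ### The twisted fixed point `h = g + u · (h^ψ ∘ f)` -/

variable (f) in
/-- The approximants `h_0 = 0`, `h_{M+1} = g + u·(h_M^ψ ∘ f)`. [cite: deShalit1987, Ch. I §3.13 Lemma (proof)] -/
def twistFixSeq (ψ : S →+* S) (u : S) (g : PowerSeries S) : ℕ → PowerSeries S
  | 0 => 0
  | M + 1 => g + PowerSeries.C u * PowerSeries.subst f (PowerSeries.map ψ (twistFixSeq ψ u g M))

/-- Unfolding. [cite: deShalit1987, Ch. I §3.13 Lemma (proof)] -/
theorem twistFixSeq_succ (ψ : S →+* S) (u : S) (g : PowerSeries S) (M : ℕ) :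
    twistFixSeq f ψ u g (M + 1) = g + PowerSeries.C u * PowerSeries.subst f (PowerSeries.map ψ (twistFixSeq f ψ u g M)) :=
  rfl

include hf0 in
/-- `(h ∘ f)(0) = h(0)`. [cite: deShalit1987, Ch. I §3.13 Lemma (proof)] -/
theorem constantCoeff_subst_eq (h : PowerSeries S) :
    PowerSeries.constantCoeff (PowerSeries.subst f h) = PowerSeries.constantCoeff h := by
  have hfs : PowerSeries.HasSubst f := PowerSeries.HasSubst.of_constantCoeff_zero' hf0
  have e := PowerSeries.eq_X_mul_shift_add_const h
  conv_lhs => rw [e]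
  rw [PowerSeries.subst_add hfs, PowerSeries.subst_mul hfs, PowerSeries.subst_X hfs, PowerSeries.subst_C]
  change PowerSeries.constantCoeff (f * _ + PowerSeries.C _) = _
  rw [map_add, map_mul, hf0, zero_mul, zero_add, PowerSeries.constantCoeff_C]

include hf0 in
/-- `h_M(0) = 0` when `g(0) = 0`. [cite: deShalit1987, Ch. I §3.13 Lemma (proof)] -/
theorem constantCoeff_twistFixSeq (ψ : S →+* S) (u : S) {g : PowerSeries S} (hg : PowerSeries.constantCoeff g = 0) :
    ∀ M, PowerSeries.constantCoeff (twistFixSeq f ψ u g M) = 0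
  | 0 => by simp [twistFixSeq]
  | M + 1 => by
    rw [twistFixSeq_succ, map_add, map_mul, constantCoeff_subst_eq hf0, constantCoeff_map',
      constantCoeff_twistFixSeq ψ u hg M, map_zero, mul_zero, add_zero, hg]

include hf0 hf1 in
/-- `h_{M+1} − h_M ∈ I_{M+1}`. [cite: deShalit1987, Ch. I §3.13 Lemma (proof)] -/
theorem twistFixSeq_succ_sub_mem {ψ : S →+* S} (hψ : ψ p = p) (u : S) {g : PowerSeries S}
    (hg : PowerSeries.constantCoeff g = 0) :
    ∀ M, twistFixSeq f ψ u g (M + 1) - twistFixSeq f ψ u g M ∈ adicFiltGen p (M + 1)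
  | 0 => by
    have hfs : PowerSeries.HasSubst f := PowerSeries.HasSubst.of_constantCoeff_zero' hf0
    rw [twistFixSeq_succ]
    simp only [twistFixSeq]
    rw [map_zero, ← PowerSeries.coe_substAlgHom hfs, map_zero, mul_zero, add_zero, sub_zero]
    exact mem_adicFiltGen_one_of_constantCoeff_eq_zero hg
  | M + 1 => by
    have hfs : PowerSeries.HasSubst f := PowerSeries.HasSubst.of_constantCoeff_zero' hf0
    have e : twistFixSeq f ψ u g (M + 1 + 1) - twistFixSeq f ψ u g (M + 1) =
        PowerSeries.C u * PowerSeries.subst f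
          (PowerSeries.map ψ (twistFixSeq f ψ u g (M + 1) - twistFixSeq f ψ u g M)) := by
      rw [twistFixSeq_succ, twistFixSeq_succ, map_sub, ← PowerSeries.coe_substAlgHom hfs, map_sub]; ring
    rw [e]
    refine Ideal.mul_mem_left _ _ (subst_mem_adicFiltGen_succ hf0 hf1 (M + 1)
      (map_mem_adicFiltGen hψ (twistFixSeq_succ_sub_mem hψ u hg M)) ?_)
    rw [constantCoeff_map', map_sub, constantCoeff_twistFixSeq hf0 ψ u hg,
      constantCoeff_twistFixSeq hf0 ψ u hg, sub_zero, map_zero]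

include hf0 hf1 in
/-- ★★ **The twisted equation `h = g + u · (h^ψ ∘ f)` has a solution with `h(0) = 0`** for every `g` with `g(0) = 0`,
every constant `u` and every ring endomorphism `ψ` with `ψ(p) = p`, when `S` is `(p)`-adically complete
(`h = lim h_M`, a `(p, X)`-adic limit). [cite: deShalit1987, Ch. I §3.13 Lemma] -/
theorem exists_eq_add_C_mul_map_subst [IsAdicComplete (Ideal.span {p}) S] {ψ : S →+* S} (hψ : ψ p = p) (u : S)
    {g : PowerSeries S} (hg : PowerSeries.constantCoeff g = 0) :
    ∃ h : PowerSeries S, PowerSeries.constantCoeff h = 0 ∧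
      h = g + PowerSeries.C u * PowerSeries.subst f (PowerSeries.map ψ h) := by
  have hfs : PowerSeries.HasSubst f := PowerSeries.HasSubst.of_constantCoeff_zero' hf0
  obtain ⟨H, hH⟩ := exists_forall_sub_mem_adicFiltGen (p := p) (twistFixSeq f ψ u g)
    (twistFixSeq_succ_sub_mem hf0 hf1 hψ u hg)
  have hH0 : PowerSeries.constantCoeff H = 0 := by
    refine IsHausdorff.haus' (I := Ideal.span {p}) _ fun i => ?_
    rw [SModEq.sub_mem, sub_zero, smul_eq_mul, Ideal.mul_top, Ideal.span_singleton_pow]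
    have := hH i 0
    rw [Nat.sub_zero, map_sub, PowerSeries.coeff_zero_eq_constantCoeff, constantCoeff_twistFixSeq hf0 ψ u hg,
      sub_zero] at this
    exact Ideal.mem_span_singleton.mpr (dvd_trans (pow_dvd_pow _ (Nat.le_succ i)) (Ideal.mem_span_singleton.mp this))
  refine ⟨H, hH0, ?_⟩
  rw [← sub_eq_zero]
  refine eq_zero_of_forall_mem_adicFiltGen (p := p) fun N => ?_
  have e : H - (g + PowerSeries.C u * PowerSeries.subst f (PowerSeries.map ψ H)) =
      (H - twistFixSeq f ψ u g (N + 1)) -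
        PowerSeries.C u * PowerSeries.subst f (PowerSeries.map ψ (H - twistFixSeq f ψ u g N)) := by
    rw [twistFixSeq_succ, map_sub, ← PowerSeries.coe_substAlgHom hfs, map_sub]; ring
  rw [e]
  refine adicFiltGen_mono (by omega) (sub_mem (hH (N + 1)) (Ideal.mul_mem_left _ _
    (subst_mem_adicFiltGen_succ hf0 hf1 (N + 1) (map_mem_adicFiltGen hψ (hH N)) ?_)))
  rw [constantCoeff_map', map_sub, hH0, constantCoeff_twistFixSeq hf0 ψ u hg, sub_zero, map_zero]

include hf0 hf1 in
/-- ★ **Uniqueness**: two solutions of `h = g + u · (h^ψ ∘ f)` with the same constant term coincide (their difference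
`d` satisfies `d = u · (d^ψ ∘ f)`, `d(0) = 0`, so `d ∈ ⋂ I_N = 0`), when `S` is `(p)`-adically Hausdorff.
[cite: deShalit1987, Ch. I §3.14] -/
theorem eq_of_eq_add_C_mul_map_subst [IsHausdorff (Ideal.span {p}) S] {ψ : S →+* S} (hψ : ψ p = p) (u : S)
    {g h h' : PowerSeries S} (hh : h = g + PowerSeries.C u * PowerSeries.subst f (PowerSeries.map ψ h))
    (hh' : h' = g + PowerSeries.C u * PowerSeries.subst f (PowerSeries.map ψ h'))
    (h0 : PowerSeries.constantCoeff h = PowerSeries.constantCoeff h') : h = h' := by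
  have hfs : PowerSeries.HasSubst f := PowerSeries.HasSubst.of_constantCoeff_zero' hf0
  rw [← sub_eq_zero]
  set d := h - h' with hd
  have hdfix : d = PowerSeries.C u * PowerSeries.subst f (PowerSeries.map ψ d) := by
    rw [hd, map_sub, ← PowerSeries.coe_substAlgHom hfs, map_sub, PowerSeries.coe_substAlgHom]
    conv_lhs => rw [hh, hh']
    ring
  have hd0 : PowerSeries.constantCoeff d = 0 := by rw [hd, map_sub, h0, sub_self]
  have hmem : ∀ N, d ∈ adicFiltGen p N := by
    intro N
    induction N with
    | zero => exact mem_adicFiltGen_zero _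
    | succ N ih =>
      rw [hdfix]
      refine Ideal.mul_mem_left _ _ (subst_mem_adicFiltGen_succ hf0 hf1 N (map_mem_adicFiltGen hψ ih) ?_)
      rw [constantCoeff_map', hd0, map_zero]
  exact eq_zero_of_forall_mem_adicFiltGen (p := p) hmem

end AdicFixedPoint

end LubinTate

end Literature.NumberTheory.GaloisRepresentations
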